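import Literature.MathematicalPhysics.QuantumFieldTheory.Balaban1983to89.B9Ineq3131Assembly
import Literature.MathematicalPhysics.QuantumFieldTheory.Balaban1983to89.B9Eq336CurrentBound

/-!
# `Balaban1983to89.B9Ineq3131Regular` — B9 p. 422, inequality (3.131) with its `|J|`-input DISCHARGED from the regularity
# conditions (3.35)–(3.36): the bookkeeping of `B9Ineq3131Assembly` composed with the current bound of `B9Eq336CurrentBound`

HONEST FRAMING (cell `lit-balaban`, verbatim): statement-level skeleton of published theorems with citation tags; proofs
where landed; nothing here is a claim about the Yang–Mills mass gap.

CITATION HEADER (lean-in-tree rule).  T. Bałaban, *Propagators for lattice gauge theories in a background field*, Commun.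
Math. Phys. **99** (1985) 389–434 [`Balaban1985BackgroundPropagators`] (cell paper B9; journal page = PDF page + 388),
p. 422 [PDF 34] (3.131), p. 396 [PDF 8] (3.35)–(3.36), p. 392 (3.11).  Cell `lit-balaban` seat r06 gen 4 (B9 fold owner),
SKELETON row `B9.Eq3.130` (the (3.131) member) with row `B9.Eq3.35`.

WHAT IS PRINTED.  p. 421–422: *"It is easy to find estimates for the operator Δ′_π, using Theorem 3.1 and the inequality (3.49) …
|⟨A₁,Δ′_πA₂⟩| ≦ O(1)Mα₀(‖D*A₁‖_{L¹} + (Lʲη)⁻¹‖A₁‖_{L¹})e^{−(1/2)δ₀d(y,y′)}(|D*A₂| + (L^{j′}η)⁻¹|A₂|) for supp A₁ ⊂ Δ(y), y ∈ Λ_j,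
supp A₂ ⊂ Δ(y′), y′ ∈ Λ_{j′}. (3.131)"* — for «U satisfying the regularity conditions (3.35), (3.36)» (the standing hypothesis of
Sect. D, Thm 3.12 p. 423), the factor `Mα₀` coming from the smallness of the current `J` of (3.11) («the configuration J is small»,
p. 421).

WHAT THIS FILE PROVES (theorems only; no definitions, no `Prop` placeholders).  `B9Ineq3131Assembly.ineq3131_assembled` /
`ineq3131_printed` (r06 gen 3, p247414) derive (3.131) from printed-shape inputs, among them `hJ : |J(b)| ≦ c_J·Mα₀·(L^{j(b)}η)⁻³`
— the form in which p. 422 uses (3.36).  `B9Eq336CurrentBound.norm_J_le_blocks` (r06 gen 4, p248311 + v1.1) PROVES that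
shape from the regularity datum `RegularAt` of (3.35)–(3.36) at every bond (gauge `u` with `U^u = e^{iηA}` on a site set containing
the bond's stencil, `|A| ≦ C(L^jη)⁻¹`, `|∇^ηA| ≦ C(L^jη)⁻²`, `|∂^{η*}∂^ηA| ≦ C(L^jη)⁻³`, `C = O(1)Mα₀ ≦ 1`), with `c_J·Mα₀ = 10⁴d·C`.
Composing: **`ineq3131_of_regular`** ((3.131) at a general rate `ρ`, `ρ + σ + αδ₀ ≦ δ_P`) and **`ineq3131_printed_of_regular`**
(the printed letters, rate `½δ₀`) with the `hJ` hypothesis REPLACED by `hreg : ∀ μ x, RegularAt T U η C (g.len (blk x)) μ x`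
(+ `η ≦ L^{j}η` for every block scale, automatic for `L ≧ 1`, `j ≧ 0` when the geometry's `η` is the lattice `η`).  The remaining
inputs (Theorem 3.1 (3.42) ∘ (3.49) entries `hS0…hL1`, the geometry of [4]) are untouched: Theorem 3.1 and (3.49) are statement
rows of the skeleton.

NOT CLAIMED: Theorem 3.1, (3.49), Theorem 3.12; the covering geometry «on □» beyond the abstract site sets of `RegularAt`
(cf. `B9Eq336CurrentBound` SCOPE (ii)).
-/

noncomputable section

open NormedSpace Complex

namespace Literature.MathematicalPhysics.QuantumFieldTheory.Balaban1983to89.B9Ineq3131Regular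

open Literature.MathematicalPhysics.QuantumFieldTheory.Balaban1983to89
open Literature.MathematicalPhysics.QuantumFieldTheory.Balaban1983to89.B9Eq39Adjoint (J)
open Literature.MathematicalPhysics.QuantumFieldTheory.Balaban1983to89.B9Eq3117Current (covDη)
open Literature.MathematicalPhysics.QuantumFieldTheory.Balaban1983to89.B9Eq3131Pointwise (deltaPiPrimeBil)
open Literature.MathematicalPhysics.QuantumFieldTheory.Balaban1983to89.B6RandomWalk (Triangle254 Ineq260)
open Literature.MathematicalPhysics.QuantumFieldTheory.Balaban1983to89.B11SectG (RowSum)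
open Literature.MathematicalPhysics.QuantumFieldTheory.Balaban1983to89.B9SectDSup (DistSymm)
open Literature.MathematicalPhysics.QuantumFieldTheory.Balaban1983to89.B9Ineq3131Assembly
open Literature.MathematicalPhysics.QuantumFieldTheory.Balaban1983to89.B9Eq336CurrentBound (RegularAt norm_J_le_blocks)

variable {𝔸 : Type*} [NormedRing 𝔸] [NormedAlgebra ℂ 𝔸] [CompleteSpace 𝔸]
variable {S : Type*} [Fintype S] {ι : Type*} [Fintype ι] [LinearOrder ι]
variable (T : ι → Equiv.Perm S) (U : ι → S → 𝔸ˣ)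
variable {g : B6.Geometry} (blk : S → g.Site)

open Classical in
/-- **(3.131) AT A GENERAL RATE, FOR A REGULAR BACKGROUND**: `B9Ineq3131Assembly.ineq3131_assembled` with its `|J|`-hypothesis
`hJ` discharged from (3.35)–(3.36) at every bond at the scale `L^{j(b)}η = g.len (blk b)` of its block
(`B9Eq336CurrentBound.norm_J_le_blocks`): the constant `c_J·Mα₀` of the assembly becomes `10⁴d·C`, `C = O(1)Mα₀ ≦ 1`.
[cite: Balaban1985BackgroundPropagators, (3.131) p.422, (3.35)–(3.36) p.396, (3.11) p.392, (3.42) p.397, (3.49) p.399; Balaban1984PropagatorsII, Lemma 2.1 (2.60)–(2.61) p.234, (2.54) p.233] -/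
theorem ineq3131_of_regular (hT : ∀ μ ν x, T μ (T ν x) = T ν (T μ x))
    (hU : ∀ μ x, ‖(U μ x : 𝔸)‖ ≤ 1 ∧ ‖(((U μ x)⁻¹ : 𝔸ˣ) : 𝔸)‖ ≤ 1) (τ : 𝔸 →L[ℂ] ℂ) {η : ℝ} (hη : 0 < η) (d : ℕ)
    (P : (ι → S → 𝔸) → S → 𝔸) (A₁ A₂ : ι → S → 𝔸) (y y' : g.Site)
    (hd : ∀ a b : g.Site, 0 ≤ g.dist a b) (hsym : DistSymm g) (htri : Triangle254 g)
    {σ c δ₀ α : ℝ} (hrow : RowSum g σ c) (h260 : Ineq260 g δ₀ α) (hαδ : 0 ≤ α * δ₀) (hσ : 0 ≤ σ)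
    (hL : 1 ≤ g.L) (hge : 0 < g.eta) (hRM : 2 * Real.log g.L ≤ α * δ₀ * g.R * g.M)
    {δP ρ : ℝ} (hρ : 0 ≤ ρ) (hρP : ρ + σ + α * δ₀ ≤ δP)
    (hA₁ : ∀ μ x, blk x ≠ y → A₁ μ x = 0) (hA₂ : ∀ μ x, blk x ≠ y' → A₂ μ x = 0)
    {a₂ : ℝ} (ha₂0 : 0 ≤ a₂) (ha₂ : ∀ μ x, ‖A₂ μ x‖ ≤ a₂)
    {C : ℝ} (hC0 : 0 ≤ C) (hC1 : C ≤ 1) (hηlen : ∀ z : g.Site, η ≤ g.len z)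
    (hreg : ∀ μ x, RegularAt T U η C (g.len (blk x)) μ x)
    {CP n₂ m₁ : ℝ} (hCP : 0 ≤ CP) (hn₂ : 0 ≤ n₂) (hm₁ : 0 ≤ m₁)
    (hS0 : ∀ x, ‖P A₂ x‖ ≤ CP * g.len (blk x) ^ 2 * Real.exp (-(δP * g.dist (blk x) y')) * n₂)
    (hS0s : ∀ μ x, ‖P A₂ (T μ x)‖ ≤ CP * g.len (blk x) ^ 2 * Real.exp (-(δP * g.dist (blk x) y')) * n₂)
    (hS1 : ∀ μ x, ‖covDη T U η (P A₂) μ x‖ ≤ CP * g.len (blk x) * Real.exp (-(δP * g.dist (blk x) y')) * n₂)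
    (hL0 : ∀ y'', sl1On blk η d y'' (P A₁) ≤ CP * g.len y ^ 2 * Real.exp (-(δP * g.dist y y'')) * m₁)
    (hL0s : ∀ y'' μ, sl1On blk η d y'' (P A₁ ∘ (T μ)) ≤ CP * g.len y ^ 2 * Real.exp (-(δP * g.dist y y'')) * m₁)
    (hL1 : ∀ y'', bl1On blk η d y'' (covDη T U η (P A₁)) ≤ CP * g.len y * Real.exp (-(δP * g.dist y y'')) * m₁) :
    ‖deltaPiPrimeBil T U η d (τ : 𝔸 →ₗ[ℂ] ℂ) P A₁ A₂‖ ≤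
      O1 ‖τ‖ (10 ^ 4 * Fintype.card ι) CP (Fintype.card ι) g.L c * C * (m₁ + (g.len y)⁻¹ * bl1 η d A₁)
        * Real.exp (-(ρ * g.dist y y')) * (n₂ + (g.len y')⁻¹ * a₂) :=
  ineq3131_assembled T U blk hU τ hη d P A₁ A₂ y y' hd hsym htri hrow h260 hαδ hσ hL hge hRM hρ hρP hA₁ hA₂ ha₂0 ha₂
    (cJ := 10 ^ 4 * Fintype.card ι) (Ma := C) (by positivity) hC0
    (fun μ x => norm_J_le_blocks T hT hη hC0 hC1 U blk g.len hηlen hreg μ x) hCP hn₂ hm₁ hS0 hS0s hS1 hL0 hL0s hL1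

open Classical in
/-- **(3.131) IN THE PRINTED LETTERS, FOR A REGULAR BACKGROUND** (`B9Ineq3131Assembly.ineq3131_printed` with `hJ` discharged):
`|⟨A₁,Δ′_πA₂⟩| ≦ O₁·C·(‖D*A₁‖_{L¹} + (Lʲη)⁻¹‖A₁‖_{L¹})·e^{−½δ₀d(y,y′)}·(|D*A₂| + (L^{j′}η)⁻¹|A₂|)` with
`O₁ = O1 ‖τ‖ (10⁴d) C_P d L c`, for `U` unit-bounded and regular in the sense of (3.35)–(3.36) at every bond
(`RegularAt`, constant `C = O(1)Mα₀ ≦ 1`). [cite: Balaban1985BackgroundPropagators, (3.131) p.422, (3.35)–(3.36) p.396, (3.11) p.392] -/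
theorem ineq3131_printed_of_regular (hT : ∀ μ ν x, T μ (T ν x) = T ν (T μ x))
    (hU : ∀ μ x, ‖(U μ x : 𝔸)‖ ≤ 1 ∧ ‖(((U μ x)⁻¹ : 𝔸ˣ) : 𝔸)‖ ≤ 1) (τ : 𝔸 →L[ℂ] ℂ) {η : ℝ} (hη : 0 < η) (d : ℕ)
    (P : (ι → S → 𝔸) → S → 𝔸) (A₁ A₂ : ι → S → 𝔸) (y y' : g.Site)
    (hd : ∀ a b : g.Site, 0 ≤ g.dist a b) (hsym : DistSymm g) (htri : Triangle254 g)
    {σ c δ₀ α : ℝ} (hrow : RowSum g σ c) (h260 : Ineq260 g δ₀ α) (hαδ : 0 ≤ α * δ₀) (hσ : 0 ≤ σ)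
    (hhalf : σ + α * δ₀ ≤ δ₀ / 2)
    (hL : 1 ≤ g.L) (hge : 0 < g.eta) (hRM : 2 * Real.log g.L ≤ α * δ₀ * g.R * g.M)
    (hA₁ : ∀ μ x, blk x ≠ y → A₁ μ x = 0) (hA₂ : ∀ μ x, blk x ≠ y' → A₂ μ x = 0)
    {C : ℝ} (hC0 : 0 ≤ C) (hC1 : C ≤ 1) (hηlen : ∀ z : g.Site, η ≤ g.len z)
    (hreg : ∀ μ x, RegularAt T U η C (g.len (blk x)) μ x)
    {CP : ℝ} (hCP : 0 ≤ CP)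
    (hS0 : ∀ x, ‖P A₂ x‖ ≤ CP * g.len (blk x) ^ 2 * Real.exp (-(δ₀ * g.dist (blk x) y')) * ssup (divBη T U η A₂))
    (hS0s : ∀ μ x, ‖P A₂ (T μ x)‖ ≤ CP * g.len (blk x) ^ 2 * Real.exp (-(δ₀ * g.dist (blk x) y')) * ssup (divBη T U η A₂))
    (hS1 : ∀ μ x, ‖covDη T U η (P A₂) μ x‖
      ≤ CP * g.len (blk x) * Real.exp (-(δ₀ * g.dist (blk x) y')) * ssup (divBη T U η A₂))
    (hL0 : ∀ y'', sl1On blk η d y'' (P A₁) ≤ CP * g.len y ^ 2 * Real.exp (-(δ₀ * g.dist y y'')) * sl1 η d (divBη T U η A₁))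
    (hL0s : ∀ y'' μ, sl1On blk η d y'' (P A₁ ∘ (T μ))
      ≤ CP * g.len y ^ 2 * Real.exp (-(δ₀ * g.dist y y'')) * sl1 η d (divBη T U η A₁))
    (hL1 : ∀ y'', bl1On blk η d y'' (covDη T U η (P A₁))
      ≤ CP * g.len y * Real.exp (-(δ₀ * g.dist y y'')) * sl1 η d (divBη T U η A₁)) :
    ‖deltaPiPrimeBil T U η d (τ : 𝔸 →ₗ[ℂ] ℂ) P A₁ A₂‖ ≤
      O1 ‖τ‖ (10 ^ 4 * Fintype.card ι) CP (Fintype.card ι) g.L c * C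
        * (sl1 η d (divBη T U η A₁) + (g.len y)⁻¹ * bl1 η d A₁)
        * Real.exp (-((1 / 2 : ℝ) * δ₀ * g.dist y y')) * (ssup (divBη T U η A₂) + (g.len y')⁻¹ * bsup A₂) :=
  ineq3131_printed T U blk hU τ hη d P A₁ A₂ y y' hd hsym htri hrow h260 hαδ hσ hhalf hL hge hRM hA₁ hA₂
    (cJ := 10 ^ 4 * Fintype.card ι) (Ma := C) (by positivity) hC0
    (fun μ x => norm_J_le_blocks T hT hη hC0 hC1 U blk g.len hηlen hreg μ x) hCP hS0 hS0s hS1 hL0 hL0s hL1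

end Literature.MathematicalPhysics.QuantumFieldTheory.Balaban1983to89.B9Ineq3131Regular
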